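import Summits.QuantumFields.YangMills.Theorems.UnitScaleTiltProp7H128OfCrit127Family
import Summits.QuantumFields.YangMills.Theorems.UnitScaleTiltProp7SectET3WCurrentProp4RowsT3
import Summits.QuantumFields.YangMills.Theorems.UnitScaleTiltProp7Row84AtEtaSlotMemberT3
import Summits.QuantumFields.YangMills.Theorems.UnitScaleTiltProp7SectET3WChartHermitianT3
import Summits.QuantumFields.YangMills.Theorems.UnitScaleTiltProp7SectET3WCurrentRealityLettersT3
import Summits.QuantumFields.YangMills.Theorems.UnitScaleTiltProp7RCOfRowsFamily
import HarnessLib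

/-!
# Route `UnitScaleTilt`, crux «MinimiserStabilityRegPr» (stmt-QuantumFields-19200, stub EX), route (α) — **«HZ84-FAMILY-AT-RECORD»: THE LATTICE (84) ROW `hZ84` OF ★px16's H128 DOORS
# (✓p681225 :196 ∕ ✓p686481) AND OF ★px21's HCRIT93 DOOR (✓p687039), AT THE LETTERS OF RECORD `Wf :=` the (W-X′) letter `W80 ρ₂ tr U₀♭ H̃ᴾ C̃ εC Ĵ Δ̂η`, `Tcf := T47 H̃ᴾ C̃ (εC L)`,
# AS A FAMILY THEOREM** (EX namer ★w2-19200 g7 WORD (22) 2026-08-29T01:39Z «px21 g4: HZ84-FAMILY + HCHART-FAMILY GO … type them ONCE as family theorems and feed both»).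

Cell `ym3-torus` (HUMAN RULING D-0037, YM ladder rung R3 — YM₃ on T³, NOT d = 4, NOT Clay; YM gap NOT proved), width seat `ym3-torus-px21` (gen 4).  THEOREMS ONLY (0 `def`, 0 `sorry`);
`--supports stmt-QuantumFields-19200 --as helper`, count-neutral; NOT a display change by itself; nothing of the stub ∕ crux ∕ gap claimed.

THE PRINT.  [Balaban1985Variational] (84) p.290 «⟨(δ∕δA′)𝔉(A′), δA′⟩ = ⟨δA′, J⟩ + ⟨δA′, Δ₁A′⟩ + ⟨(δ∕δA′)V(A′), δA′⟩» along the ray `A′ + tδ′` through the chart (47) `A′ ↦ A′ − HD(A′)` (lit `T47`);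
member theorem ★px21 ✓`Prop7Row84AtEtaSlotMember.hasDerivAt_actionZ_chartRay_real_member_eta` (lit ✓`B11Eq81ExpansionZpow.hasDerivAt_actionZ_chartRay_real` at `Δπ := Δ̂^η`, `Δ₁ := Δ̂^η + T̂_Jᴾ`,
`H := H̃ᴾ`, `C := C̃`).  Its displayed rows are THEOREMS at the letters of record: `hρ` (✓`Prop7SectET3WCurrentRealityLetters.trace_rieszτ_frobEquiv_mul`, ★px3), the Sect. C regime `RC`
(★px14 ✓`Prop7RCOfRowsFamily.hRC_of_rows_family_B₀` — kept here as the family binder `hRC` in its conclusion's shape), `hC` (★px3 ✓`Prop7SectET3WCurrentProp4Rows.prop4Hyp_CmapTwS_conj_zeroJet`),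
`hPT` (★px3 ✓`Prop7SectET3WChartHermitian.T47_hermitian_readings_at_record` from `RC`); the point `A′ = A₁ + H₁B̃` is Hermitian (✓`hA₁R_of_letterReality` + `hH₁R` ∘ ✓`bsym_isHermitian_trace_zero`)
and of size `< r + 2B₀α ≤ a₃` (`norm_H₁` ∘ ✓`bound20_symLog_of_closeAvg`, `hrα hr4`).

WHAT IS PROVED (ns `…Theorems.Prop7HZ84FamilyAtRecord`): ★★★`hZ84_family_at_record` — CONCLUSION = ✓p681225's `hZ84` binder (:196–223) with `Wf L i U₀ ↦` the W80 letter of record and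
`Tcf L i U₀ ↦ T47 H̃ᴾ C̃ (εC L)` (the β-reduct of the namer's S18 instantiation); HYPOTHESES = the display's letter rows at the letters of record (`norm_G prop4 norm_H₁ h𝒢R hWR hH₁R`, S16ᴰ ∕ S14ᴰ ∕
✓p681922 texts VERBATIM), `hrα hr4 hr16`, `ef hef hWe hWε`, and `hRC` (✓p682625's conclusion VERBATIM).
HONEST SCOPE.  Composition by name; no estimate of [B11] Sect. C is proved here; not a proof of the stub.

References: T. Bałaban, CMP **102** (1985) 277–309 [Balaban1985Variational] ((84) p.290, (47)–(51) pp.285–286, (74) p.289, (78)–(81) p.290, (111) p.294, Prop. 6 p.295, (19)–(20) p.281, (117)–(121) p.295);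
CMP **99** (1985) 389–434 [Balaban1985BackgroundPropagators] ((3.10)–(3.12) p.392, (3.127)–(3.128) p.421).
-/

set_option autoImplicit false
noncomputable section
open scoped InnerProductSpace BigOperators Matrix.Norms.L2Operator Matrix Topology

namespace Summit.QuantumFields.YangMills.Theorems.Prop7HZ84FamilyAtRecord

open NormedSpace
open Literature.MathematicalPhysics.QuantumFieldTheory.Balaban1983to89
open Literature.MathematicalPhysics.QuantumFieldTheory.Balaban1983to89.T3ContinuumYM3Torus
open Literature.MathematicalPhysics.QuantumFieldTheory.Balaban1983to89.T3UnitLawDensityEML (ℰp)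
open Literature.MathematicalPhysics.QuantumFieldTheory.Balaban1983to89.T3TiltDescent (descendTo)
open Literature.MathematicalPhysics.QuantumFieldTheory.Balaban1983to89.T3PrintedRegularMinimiser (RegPr)
open Literature.MathematicalPhysics.QuantumFieldTheory.Balaban1983to89.T3PrintedMinimiserExistence (regPr_mono)
open Literature.MathematicalPhysics.QuantumFieldTheory.Balaban1983to89.T3Thm1Carrier
open Literature.MathematicalPhysics.QuantumFieldTheory.Balaban1983to89.T3SectALandauChart (In19 emb15 CloseAvg eta)
open B9SectCLatticeCarrier (Bond)
open B9Eq311L2Pairing (WL2)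
open B11Eq115Space (NegSup NegSize Space115 JetSup)
open B11Eq111FrakG (nabla115)
open B11Eq98CurrentSlot (Jcur)
open B11Eq103H1Complex (BondL2K funEquiv)
open B11Eq90Transpose (pair27)
open B11Eq90V0primeCurrent (Tsh Ucur curL flat115)
open B11Eq90V0GroupComposed (T47)
open B11Eq80Current (W80)
open B11Eq174Chart (Regime)
open B11Eq98V0primeCurrentSlots (rieszτ)
open B9Eq3119DeltaPiCarrier (currentCLM)
open B9Eq39Adjoint (prodCfg)
open B9Eq31ActionZpow (actionZ)
open B11Prop3Model (Dfix)
open B13Contraction113 (QuadAnalytic)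
open MatrixLog (mlog)
open Summit.QuantumFields.YangMills.Theorems.Prop7TPrint (expHermField)
open Summit.QuantumFields.YangMills.Theorems.Prop7SPrint (IsLandauPrintS)
open Summit.QuantumFields.YangMills.Theorems.Prop7SectET3Transport (periodsT3 bgOfCfg bondEquiv)
open Summit.QuantumFields.YangMills.Theorems.Prop7SectET3HilbertLetters (W₂ frobEquiv toL2)
open Summit.QuantumFields.YangMills.Theorems.Prop7SectET3CurvedPropagators (Qk H1f frakGfR)
open Summit.QuantumFields.YangMills.Theorems.Prop7SectET3WilsonHessian (DeltaEtaSlot)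
open Summit.QuantumFields.YangMills.Theorems.Prop7SectET3DeltaOnePInv (TJSlotP DeltaOnePJ)
open Summit.QuantumFields.YangMills.Theorems.Prop7SectET3DeltaPiPInv (DeltaPiSlotP H46P)
open Summit.QuantumFields.YangMills.Theorems.Prop7SymAvgTwSym (QTwS CmapTwS)
open Summit.QuantumFields.YangMills.Theorems.Prop7Bound20SymLog (bound20_symLog_of_closeAvg)
open Summit.QuantumFields.YangMills.Theorems.Prop7StubEXOfChartPiecesTwSR (bsym_isHermitian_trace_zero)
open Summit.QuantumFields.YangMills.Theorems.Prop7SolutionRealityRowS (hA₁R_of_letterReality)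
open Summit.QuantumFields.YangMills.Theorems.Prop7StubEXOfChartPiecesTwL (windows_of_admissible three_le_memberL)
open Summit.QuantumFields.YangMills.Theorems.Prop7StubEXOfChartPiecesTwS (windows_of_W)
open Summit.QuantumFields.YangMills.Theorems.Prop7Row84AtEtaSlotMember (hasDerivAt_actionZ_chartRay_real_member_eta)
open Summit.QuantumFields.YangMills.Theorems.Prop7SectET3WChartHermitian (T47_hermitian_readings_at_record)
open Summit.QuantumFields.YangMills.Theorems.Prop7SectET3WCurrentRealityLetters (trace_rieszτ_frobEquiv_mul)
open Summit.QuantumFields.YangMills.Theorems.Prop7SectET3WCurrentProp4Rows (prop4Hyp_CmapTwS_conj_zeroJet)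

set_option maxHeartbeats 400000 in -- HEARTBEAT BUDGET rule (cell README): ~35-binder family context + reader rewrites; line-neutral, decl-local
/-- ★★★ **THE (84) ROW `hZ84` AT THE LETTERS OF RECORD, FAMILY SHAPE**: for every member, every printed-regular `U₀ ∈ 𝔅_k(V)` of radius `L³·3L·ε₁ ≤ α`, every (111)-solution `A₁` in the
`r`-ball and every Hermitian traceless `QTwS`-null direction `ιδ′`, lit's `actionZ` along the chart ray `T47 H̃ᴾ C̃ εC (A′ + tδ′)`, `A′ = A₁ + H₁B̃`, has derivative
`⟨δ′, J⟩ + ⟨δ′, (Δ̂^η + T̂_Jᴾ)A′⟩ + ⟨δ′, W80 … A′⟩` at `0` — ✓p681225's `hZ84` binder with `Wf`, `Tcf` := the letters of record.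
[cite: Balaban1985Variational, (84) p.290, (47)-(51) pp.285-286, (74) p.289, (78)-(81) p.290, (111) p.294, Prop. 6 p.295, (19)-(20) p.281, (117)-(121) p.295; Balaban1985BackgroundPropagators, (3.10)-(3.12) p.392, (3.127)-(3.128) p.421] -/
theorem hZ84_family_at_record
    [hFL : ∀ F : T3Family, Fact (0 < (F.L : ℝ))] [hFη : ∀ (F : T3Family) (k : ℕ), Fact (0 < ((F.L : ℝ)⁻¹) ^ k)]
    (B₀ C₄ a₃ α r : ℕ → ℝ) (hB₀ : ∀ L, 1 < L → 0 < B₀ L) (hC₄ : ∀ L, 1 < L → 0 < C₄ L)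
    (hα : ∀ L, 1 < L → 0 < α L)
    (c₀ cB : ℕ → ℝ) [hc₀ : ∀ L : ℕ, Fact (0 < c₀ L)] [hcB : ∀ L : ℕ, Fact (0 < cB L)]
    (a : ∀ L : ℕ, Idx L → ℝ) (ha : ∀ (L : ℕ) (i : Idx L), 0 < a L i)
    -- the Prop-3 chart radius of the (W-X′) letter of record
    (εC : ℕ → ℝ)
    -- the displayed letter rows at the letters of record (S16ᴰ VERBATIM: `norm_G norm_H₁`; `h𝒢R hH₁R` = ★px3 ✓p685025; `prop4` = ★px5 ✓p683940 ∘ …; `hWR` = ★px3 ✓p681922 ∘ …)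
    (norm_G : ∀ (L : ℕ), 1 < L → ∀ (i : Idx L) (ρ : ℝ) (U₀ : GaugeField (i.1.1.P i.1.2.2) 0 (Matrix.specialUnitaryGroup (Fin 2) ℂ)),
      RegPr i.1.1 i.1.2.1 i.1.2.2 ρ U₀ → ρ ≤ α L → ∀ f, ‖frakGfR i.1.1 i.1.2.1 i.1.2.2 i.2.2.le (c₀ L) (cB L) (a L i) (DeltaOnePJ i.1.1 i.1.2.1 i.1.2.2 i.2.2.le (c₀ L) (cB L) (a L i)) U₀ f‖ ≤ B₀ L * ‖f‖)
    (prop4 : ∀ (L : ℕ), 1 < L → ∀ (i : Idx L) (ρ : ℝ) (U₀ : GaugeField (i.1.1.P i.1.2.2) 0 (Matrix.specialUnitaryGroup (Fin 2) ℂ)),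
      RegPr i.1.1 i.1.2.1 i.1.2.2 ρ U₀ → ρ ≤ α L → QuadAnalytic
          (W80 (rieszτ frobEquiv) (LinearMap.toContinuousLinearMap (Matrix.traceLinearMap (Fin 2) ℂ ℂ)) (bgOfCfg i.1.1 i.1.2.2 U₀) (H1f i.1.1 i.1.2.1 i.1.2.2 i.2.2.le (c₀ L) (cB L) (a L i) (DeltaPiSlotP i.1.1 i.1.2.1 i.1.2.2 i.2.2.le (c₀ L) (cB L) (a L i)) U₀)
            (fun A' => (-Complex.I) • CmapTwS i.1.1 i.1.2.1 i.1.2.2 i.2.2.le U₀ (((((eta i.1.1 i.1.2.1 i.1.2.2 : ℝ) : ℂ)) * Complex.I) • (fun b : PBond (i.1.1.P i.1.2.2) 0 => JetSup.equiv _ _ _ A' (bondEquiv i.1.1 i.1.2.2 b)))) (εC L) (Jcur (bgOfCfg i.1.1 i.1.2.2 U₀))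
            (currentCLM frobEquiv (fun _ : Bond 3 (periodsT3 i.1.1 i.1.2.2) × Fin 3 => i.1.2.2 - i.1.2.1) (nabla115 (((i.1.1.L : ℝ)⁻¹) ^ (i.1.2.2 - i.1.2.1)) (bgOfCfg i.1.1 i.1.2.2 U₀)) (DeltaEtaSlot i.1.1 i.1.2.1 i.1.2.2 (c₀ L) U₀))) (C₄ L) (a₃ L))
    (norm_H₁ : ∀ (L : ℕ), 1 < L → ∀ (i : Idx L) (ρ : ℝ) (U₀ : GaugeField (i.1.1.P i.1.2.2) 0 (Matrix.specialUnitaryGroup (Fin 2) ℂ)),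
      RegPr i.1.1 i.1.2.1 i.1.2.2 ρ U₀ → ρ ≤ α L → ∀ b, ‖H1f i.1.1 i.1.2.1 i.1.2.2 i.2.2.le (c₀ L) (cB L) (a L i) (DeltaOnePJ i.1.1 i.1.2.1 i.1.2.2 i.2.2.le (c₀ L) (cB L) (a L i)) U₀ b‖ ≤ B₀ L * ‖b‖)
    (h𝒢R : ∀ (L : ℕ), 1 < L → ∀ (i : Idx L) (U₀ : GaugeField (i.1.1.P i.1.2.2) 0 (Matrix.specialUnitaryGroup (Fin 2) ℂ)), RegPr i.1.1 i.1.2.1 i.1.2.2 (α L) U₀ →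
      ∀ f : NegSize (i.1.1.L : ℝ) (((i.1.1.L : ℝ)⁻¹) ^ (i.1.2.2 - i.1.2.1)) (fun _ : Bond 3 (periodsT3 i.1.1 i.1.2.2) => i.1.2.2 - i.1.2.1) 3 (Matrix (Fin 2) (Fin 2) ℂ),
        (∀ b, (NegSup.equiv _ _ f b).IsHermitian ∧ (NegSup.equiv _ _ f b).trace = 0) →
        ∀ b, (JetSup.equiv _ _ _ (frakGfR i.1.1 i.1.2.1 i.1.2.2 i.2.2.le (c₀ L) (cB L) (a L i) (DeltaOnePJ i.1.1 i.1.2.1 i.1.2.2 i.2.2.le (c₀ L) (cB L) (a L i)) U₀ f) b).IsHermitian ∧ (JetSup.equiv _ _ _ (frakGfR i.1.1 i.1.2.1 i.1.2.2 i.2.2.le (c₀ L) (cB L) (a L i) (DeltaOnePJ i.1.1 i.1.2.1 i.1.2.2 i.2.2.le (c₀ L) (cB L) (a L i)) U₀ f) b).trace = 0)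
    (hWR : ∀ (L : ℕ), 1 < L → ∀ (i : Idx L) (U₀ : GaugeField (i.1.1.P i.1.2.2) 0 (Matrix.specialUnitaryGroup (Fin 2) ℂ)), RegPr i.1.1 i.1.2.1 i.1.2.2 (α L) U₀ →
      ∀ A : Space115 (i.1.1.L : ℝ) (((i.1.1.L : ℝ)⁻¹) ^ (i.1.2.2 - i.1.2.1)) (fun _ : Bond 3 (periodsT3 i.1.1 i.1.2.2) => i.1.2.2 - i.1.2.1)
          (fun _ : Bond 3 (periodsT3 i.1.1 i.1.2.2) × Fin 3 => i.1.2.2 - i.1.2.1) (nabla115 (((i.1.1.L : ℝ)⁻¹) ^ (i.1.2.2 - i.1.2.1)) (bgOfCfg i.1.1 i.1.2.2 U₀)),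
        ‖A‖ < a₃ L → (∀ b, (JetSup.equiv _ _ _ A b).IsHermitian ∧ (JetSup.equiv _ _ _ A b).trace = 0) →
        ∀ b, (NegSup.equiv _ _ (W80 (rieszτ frobEquiv) (LinearMap.toContinuousLinearMap (Matrix.traceLinearMap (Fin 2) ℂ ℂ)) (bgOfCfg i.1.1 i.1.2.2 U₀) (H1f i.1.1 i.1.2.1 i.1.2.2 i.2.2.le (c₀ L) (cB L) (a L i) (DeltaPiSlotP i.1.1 i.1.2.1 i.1.2.2 i.2.2.le (c₀ L) (cB L) (a L i)) U₀)
            (fun A' => (-Complex.I) • CmapTwS i.1.1 i.1.2.1 i.1.2.2 i.2.2.le U₀ (((((eta i.1.1 i.1.2.1 i.1.2.2 : ℝ) : ℂ)) * Complex.I) • (fun b : PBond (i.1.1.P i.1.2.2) 0 => JetSup.equiv _ _ _ A' (bondEquiv i.1.1 i.1.2.2 b)))) (εC L) (Jcur (bgOfCfg i.1.1 i.1.2.2 U₀))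
            (currentCLM frobEquiv (fun _ : Bond 3 (periodsT3 i.1.1 i.1.2.2) × Fin 3 => i.1.2.2 - i.1.2.1) (nabla115 (((i.1.1.L : ℝ)⁻¹) ^ (i.1.2.2 - i.1.2.1)) (bgOfCfg i.1.1 i.1.2.2 U₀)) (DeltaEtaSlot i.1.1 i.1.2.1 i.1.2.2 (c₀ L) U₀)) A) b).IsHermitian ∧
          (NegSup.equiv _ _ (W80 (rieszτ frobEquiv) (LinearMap.toContinuousLinearMap (Matrix.traceLinearMap (Fin 2) ℂ ℂ)) (bgOfCfg i.1.1 i.1.2.2 U₀) (H1f i.1.1 i.1.2.1 i.1.2.2 i.2.2.le (c₀ L) (cB L) (a L i) (DeltaPiSlotP i.1.1 i.1.2.1 i.1.2.2 i.2.2.le (c₀ L) (cB L) (a L i)) U₀)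
            (fun A' => (-Complex.I) • CmapTwS i.1.1 i.1.2.1 i.1.2.2 i.2.2.le U₀ (((((eta i.1.1 i.1.2.1 i.1.2.2 : ℝ) : ℂ)) * Complex.I) • (fun b : PBond (i.1.1.P i.1.2.2) 0 => JetSup.equiv _ _ _ A' (bondEquiv i.1.1 i.1.2.2 b)))) (εC L) (Jcur (bgOfCfg i.1.1 i.1.2.2 U₀))
            (currentCLM frobEquiv (fun _ : Bond 3 (periodsT3 i.1.1 i.1.2.2) × Fin 3 => i.1.2.2 - i.1.2.1) (nabla115 (((i.1.1.L : ℝ)⁻¹) ^ (i.1.2.2 - i.1.2.1)) (bgOfCfg i.1.1 i.1.2.2 U₀)) (DeltaEtaSlot i.1.1 i.1.2.1 i.1.2.2 (c₀ L) U₀)) A) b).trace = 0)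
    (hH₁R : ∀ (L : ℕ), 1 < L → ∀ (i : Idx L) (U₀ : GaugeField (i.1.1.P i.1.2.2) 0 (Matrix.specialUnitaryGroup (Fin 2) ℂ)), RegPr i.1.1 i.1.2.1 i.1.2.2 (α L) U₀ →
      ∀ B : PBond (i.1.1.P i.1.2.1) 0 → Matrix (Fin 2) (Fin 2) ℂ, (∀ c, (B c).IsHermitian ∧ (B c).trace = 0) →
        ∀ b' : PBond (i.1.1.P i.1.2.2) 0, (JetSup.equiv _ _ _ (H1f i.1.1 i.1.2.1 i.1.2.2 i.2.2.le (c₀ L) (cB L) (a L i) (DeltaOnePJ i.1.1 i.1.2.1 i.1.2.2 i.2.2.le (c₀ L) (cB L) (a L i)) U₀ B) (bondEquiv i.1.1 i.1.2.2 b')).IsHermitian ∧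
          (JetSup.equiv _ _ _ (H1f i.1.1 i.1.2.1 i.1.2.2 i.2.2.le (c₀ L) (cB L) (a L i) (DeltaOnePJ i.1.1 i.1.2.1 i.1.2.2 i.2.2.le (c₀ L) (cB L) (a L i)) U₀ B) (bondEquiv i.1.1 i.1.2.2 b')).trace = 0)
    -- the Prop. 6 windows (reality∕uniqueness of the (111)-solution, radius `‖A′‖ < a₃`) and the (W-X′) windows
    (hrα : ∀ L : ℕ, 1 < L → 2 * B₀ L * α L ≤ r L) (hr4 : ∀ L : ℕ, 1 < L → 4 * r L ≤ a₃ L) (hr16 : ∀ L : ℕ, 1 < L → 16 * B₀ L * C₄ L * r L ≤ 1)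
    (ef : ℕ → ℝ) (hef : ∀ L, 1 < L → 0 < ef L)
    (hWe : ∀ L : ℕ, 1 < L → 10 ^ 9 * (L : ℝ) ^ 2 * ef L ≤ 1) (hWε : ∀ L : ℕ, 1 < L → 10 ^ 12 * (L : ℝ) ^ 3 * α L ≤ 1)
    -- ROW `hRC` — the Sect. C regime of `(H̃ᴾ, C̃)` at `bH := B₀` (★px14 ✓p682625 `hRC_of_rows_family_B₀`'s conclusion VERBATIM — a THEOREM from `norm_Hπ hεC hdomC hselfC hcontrC`)
    (hRC : ∀ (L : ℕ), 1 < L → ∀ (i : Idx L) (U₀ : GaugeField (i.1.1.P i.1.2.2) 0 (Matrix.specialUnitaryGroup (Fin 2) ℂ)), RegPr i.1.1 i.1.2.1 i.1.2.2 (α L) U₀ →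
      Regime (H1f i.1.1 i.1.2.1 i.1.2.2 i.2.2.le (c₀ L) (cB L) (a L i) (DeltaPiSlotP i.1.1 i.1.2.1 i.1.2.2 i.2.2.le (c₀ L) (cB L) (a L i)) U₀) 0
        (fun A' : Space115 (i.1.1.L : ℝ) (((i.1.1.L : ℝ)⁻¹) ^ (i.1.2.2 - i.1.2.1)) (fun _ : Bond 3 (periodsT3 i.1.1 i.1.2.2) => i.1.2.2 - i.1.2.1)
            (fun _ : Bond 3 (periodsT3 i.1.1 i.1.2.2) × Fin 3 => i.1.2.2 - i.1.2.1) (nabla115 (((i.1.1.L : ℝ)⁻¹) ^ (i.1.2.2 - i.1.2.1)) (bgOfCfg i.1.1 i.1.2.2 U₀)) =>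
          (-Complex.I) • CmapTwS i.1.1 i.1.2.1 i.1.2.2 i.2.2.le U₀ (((((eta i.1.1 i.1.2.1 i.1.2.2 : ℝ) : ℂ)) * Complex.I) • (fun b : PBond (i.1.1.P i.1.2.2) 0 => JetSup.equiv _ _ _ A' (bondEquiv i.1.1 i.1.2.2 b))))
        (B₀ L) 0 (40 * (2 * (3 * (2 * ef L + 2700 * (L : ℝ) * α L))) / ef L ^ 2) (ef L / 2) 0 (a₃ L) (εC L)) :
    ∀ (L : ℕ), 1 < L → ∀ (i : Idx L) (ε₁ : ℝ) (V : GaugeField (i.1.1.P i.1.2.1) 0 (Matrix.specialUnitaryGroup (Fin 2) ℂ))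
      (U₀ : GaugeField (i.1.1.P i.1.2.2) 0 (Matrix.specialUnitaryGroup (Fin 2) ℂ)), 0 < ε₁ → PlaqSmall ε₁ V →
      RegPr i.1.1 i.1.2.1 i.1.2.2 ((L : ℝ) ^ 3 * (3 * (L : ℝ)) * ε₁) U₀ → CloseAvg i.1.1 i.1.2.1 i.1.2.2 i.2.2.le ((L : ℝ) ^ 3 * ε₁) V U₀ → (L : ℝ) ^ 3 * (3 * (L : ℝ)) * ε₁ ≤ α L →
      ∀ A₁ : Space115 (i.1.1.L : ℝ) (((i.1.1.L : ℝ)⁻¹) ^ (i.1.2.2 - i.1.2.1)) (fun _ : Bond 3 (periodsT3 i.1.1 i.1.2.2) => i.1.2.2 - i.1.2.1)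
          (fun _ : Bond 3 (periodsT3 i.1.1 i.1.2.2) × Fin 3 => i.1.2.2 - i.1.2.1) (nabla115 (((i.1.1.L : ℝ)⁻¹) ^ (i.1.2.2 - i.1.2.1)) (bgOfCfg i.1.1 i.1.2.2 U₀)),
        ‖A₁‖ < r L →
        A₁ + frakGfR i.1.1 i.1.2.1 i.1.2.2 i.2.2.le (c₀ L) (cB L) (a L i) (DeltaOnePJ i.1.1 i.1.2.1 i.1.2.2 i.2.2.le (c₀ L) (cB L) (a L i)) U₀ (Jcur (bgOfCfg i.1.1 i.1.2.2 U₀)) + frakGfR i.1.1 i.1.2.1 i.1.2.2 i.2.2.le (c₀ L) (cB L) (a L i) (DeltaOnePJ i.1.1 i.1.2.1 i.1.2.2 i.2.2.le (c₀ L) (cB L) (a L i)) U₀ (W80 (rieszτ frobEquiv) (LinearMap.toContinuousLinearMap (Matrix.traceLinearMap (Fin 2) ℂ ℂ)) (bgOfCfg i.1.1 i.1.2.2 U₀) (H1f i.1.1 i.1.2.1 i.1.2.2 i.2.2.le (c₀ L) (cB L) (a L i) (DeltaPiSlotP i.1.1 i.1.2.1 i.1.2.2 i.2.2.le (c₀ L)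 (cB L) (a L i)) U₀)
            (fun A' => (-Complex.I) • CmapTwS i.1.1 i.1.2.1 i.1.2.2 i.2.2.le U₀ (((((eta i.1.1 i.1.2.1 i.1.2.2 : ℝ) : ℂ)) * Complex.I) • (fun b : PBond (i.1.1.P i.1.2.2) 0 => JetSup.equiv _ _ _ A' (bondEquiv i.1.1 i.1.2.2 b)))) (εC L) (Jcur (bgOfCfg i.1.1 i.1.2.2 U₀))
            (currentCLM frobEquiv (fun _ : Bond 3 (periodsT3 i.1.1 i.1.2.2) × Fin 3 => i.1.2.2 - i.1.2.1) (nabla115 (((i.1.1.L : ℝ)⁻¹) ^ (i.1.2.2 - i.1.2.1)) (bgOfCfg i.1.1 i.1.2.2 U₀)) (DeltaEtaSlot i.1.1 i.1.2.1 i.1.2.2 (c₀ L) U₀)) (A₁ + H1f i.1.1 i.1.2.1 i.1.2.2 i.2.2.le (c₀ L) (cB L) (a L i) (DeltaOnePJ i.1.1 i.1.2.1 i.1.2.2 i.2.2.le (c₀ L) (cB L) (a L i)) U₀ (fun c : PBond (i.1.1.P i.1.2.1) 0 =>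
          (-Complex.I) • mlog (((V c : Matrix.specialUnitaryGroup (Fin 2) ℂ) : Matrix (Fin 2) (Fin 2) ℂ)
            * star ((descendTo i.1.1 ℰp i.1.2.1 i.1.2.2 i.2.2.le U₀ c : Matrix.specialUnitaryGroup (Fin 2) ℂ) : Matrix (Fin 2) (Fin 2) ℂ))))) = 0 →
        ∀ δ' : Space115 (i.1.1.L : ℝ) (((i.1.1.L : ℝ)⁻¹) ^ (i.1.2.2 - i.1.2.1)) (fun _ : Bond 3 (periodsT3 i.1.1 i.1.2.2) => i.1.2.2 - i.1.2.1)
          (fun _ : Bond 3 (periodsT3 i.1.1 i.1.2.2) × Fin 3 => i.1.2.2 - i.1.2.1) (nabla115 (((i.1.1.L : ℝ)⁻¹) ^ (i.1.2.2 - i.1.2.1)) (bgOfCfg i.1.1 i.1.2.2 U₀)),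
          (∀ b' : PBond (i.1.1.P i.1.2.2) 0, star (JetSup.equiv _ _ _ δ' (bondEquiv i.1.1 i.1.2.2 b')) = JetSup.equiv _ _ _ δ' (bondEquiv i.1.1 i.1.2.2 b')) →
          (∀ b' : PBond (i.1.1.P i.1.2.2) 0, Matrix.trace (JetSup.equiv _ _ _ δ' (bondEquiv i.1.1 i.1.2.2 b')) = 0) →
          QTwS i.1.1 i.1.2.1 i.1.2.2 i.2.2.le U₀ (fun b' : PBond (i.1.1.P i.1.2.2) 0 => JetSup.equiv _ _ _ δ' (bondEquiv i.1.1 i.1.2.2 b')) = 0 →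
          HasDerivAt (fun t : ℝ => actionZ Tsh (((i.1.1.L : ℝ)⁻¹) ^ (i.1.2.2 - i.1.2.1)) 3
            ((LinearMap.toContinuousLinearMap (Matrix.traceLinearMap (Fin 2) ℂ ℂ) : Matrix (Fin 2) (Fin 2) ℂ →L[ℂ] ℂ) : Matrix (Fin 2) (Fin 2) ℂ →ₗ[ℂ] ℂ)
            (prodCfg (Ucur (bgOfCfg i.1.1 i.1.2.2 U₀)) (((i.1.1.L : ℝ)⁻¹) ^ (i.1.2.2 - i.1.2.1)) (curL (flat115 (T47 (H1f i.1.1 i.1.2.1 i.1.2.2 i.2.2.le (c₀ L) (cB L) (a L i) (DeltaPiSlotP i.1.1 i.1.2.1 i.1.2.2 i.2.2.le (c₀ L) (cB L) (a L i)) U₀)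
            (fun A' => (-Complex.I) • CmapTwS i.1.1 i.1.2.1 i.1.2.2 i.2.2.le U₀ (((((eta i.1.1 i.1.2.1 i.1.2.2 : ℝ) : ℂ)) * Complex.I) • (fun b : PBond (i.1.1.P i.1.2.2) 0 => JetSup.equiv _ _ _ A' (bondEquiv i.1.1 i.1.2.2 b)))) (εC L) ((A₁ + H1f i.1.1 i.1.2.1 i.1.2.2 i.2.2.le (c₀ L) (cB L) (a L i) (DeltaOnePJ i.1.1 i.1.2.1 i.1.2.2 i.2.2.le (c₀ L) (cB L) (a L i)) U₀ (fun c : PBond (i.1.1.P i.1.2.1) 0 =>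
          (-Complex.I) • mlog (((V c : Matrix.specialUnitaryGroup (Fin 2) ℂ) : Matrix (Fin 2) (Fin 2) ℂ)
            * star ((descendTo i.1.1 ℰp i.1.2.1 i.1.2.2 i.2.2.le U₀ c : Matrix.specialUnitaryGroup (Fin 2) ℂ) : Matrix (Fin 2) (Fin 2) ℂ)))) + (t : ℂ) • δ'))))))
          (pair27 (LinearMap.toContinuousLinearMap (Matrix.traceLinearMap (Fin 2) ℂ ℂ)) (Jcur (bgOfCfg i.1.1 i.1.2.2 U₀) : NegSize (i.1.1.L : ℝ) (((i.1.1.L : ℝ)⁻¹) ^ (i.1.2.2 - i.1.2.1)) (fun _ : Bond 3 (periodsT3 i.1.1 i.1.2.2) => i.1.2.2 - i.1.2.1) 3 (Matrix (Fin 2) (Fin 2) ℂ)) (flat115 δ')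
            + pair27 (LinearMap.toContinuousLinearMap (Matrix.traceLinearMap (Fin 2) ℂ ℂ))
                (currentCLM frobEquiv (fun _ : Bond 3 (periodsT3 i.1.1 i.1.2.2) × Fin 3 => i.1.2.2 - i.1.2.1) (nabla115 (((i.1.1.L : ℝ)⁻¹) ^ (i.1.2.2 - i.1.2.1)) (bgOfCfg i.1.1 i.1.2.2 U₀)) ((DeltaEtaSlot i.1.1 i.1.2.1 i.1.2.2 (c₀ L) + TJSlotP i.1.1 i.1.2.1 i.1.2.2 i.2.2.le (c₀ L) (cB L) (a L i)) U₀) (A₁ + H1f i.1.1 i.1.2.1 i.1.2.2 i.2.2.le (c₀ L) (cB L) (a L i) (DeltaOnePJ i.1.1 i.1.2.1 i.1.2.2 i.2.2.le (c₀ L) (cB L) (a L i)) U₀ (fun c : PBond (i.1.1.P i.1.2.1) 0 =>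
          (-Complex.I) • mlog (((V c : Matrix.specialUnitaryGroup (Fin 2) ℂ) : Matrix (Fin 2) (Fin 2) ℂ)
            * star ((descendTo i.1.1 ℰp i.1.2.1 i.1.2.2 i.2.2.le U₀ c : Matrix.specialUnitaryGroup (Fin 2) ℂ) : Matrix (Fin 2) (Fin 2) ℂ)))))
                (flat115 δ')
            + pair27 (LinearMap.toContinuousLinearMap (Matrix.traceLinearMap (Fin 2) ℂ ℂ)) (W80 (rieszτ frobEquiv) (LinearMap.toContinuousLinearMap (Matrix.traceLinearMap (Fin 2) ℂ ℂ)) (bgOfCfg i.1.1 i.1.2.2 U₀) (H1f i.1.1 i.1.2.1 i.1.2.2 i.2.2.le (c₀ L) (cB L) (a L i) (DeltaPiSlotP i.1.1 i.1.2.1 i.1.2.2 i.2.2.le (c₀ L) (cB L) (a L i)) U₀)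
            (fun A' => (-Complex.I) • CmapTwS i.1.1 i.1.2.1 i.1.2.2 i.2.2.le U₀ (((((eta i.1.1 i.1.2.1 i.1.2.2 : ℝ) : ℂ)) * Complex.I) • (fun b : PBond (i.1.1.P i.1.2.2) 0 => JetSup.equiv _ _ _ A' (bondEquiv i.1.1 i.1.2.2 b)))) (εC L) (Jcur (bgOfCfg i.1.1 i.1.2.2 U₀))
            (currentCLM frobEquiv (fun _ : Bond 3 (periodsT3 i.1.1 i.1.2.2) × Fin 3 => i.1.2.2 - i.1.2.1) (nabla115 (((i.1.1.L : ℝ)⁻¹) ^ (i.1.2.2 - i.1.2.1)) (bgOfCfg i.1.1 i.1.2.2 U₀)) (DeltaEtaSlot i.1.1 i.1.2.1 i.1.2.2 (c₀ L) U₀)) (A₁ + H1f i.1.1 i.1.2.1 i.1.2.2 i.2.2.le (c₀ L) (cB L) (a L i) (DeltaOnePJ i.1.1 i.1.2.1 i.1.2.2 i.2.2.le (c₀ L) (cB L) (a L i)) U₀ (fun c : PBond (i.1.1.P i.1.2.1) 0 =>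
          (-Complex.I) • mlog (((V c : Matrix.specialUnitaryGroup (Fin 2) ℂ) : Matrix (Fin 2) (Fin 2) ℂ)
            * star ((descendTo i.1.1 ℰp i.1.2.1 i.1.2.2 i.2.2.le U₀ c : Matrix.specialUnitaryGroup (Fin 2) ℂ) : Matrix (Fin 2) (Fin 2) ℂ))))) (flat115 δ')) 0 := by
  intro L hL i ε₁ V U₀ hε₁ hV hreg hclose hαe A₁ hA₁ hsol δ' hδR _hδtr _hδQ
  have hFL' : (i.1.1.L : ℝ) = (L : ℝ) := (by exact_mod_cast i.2.1); have hL1 : (1 : ℝ) ≤ (L : ℝ) := (by exact_mod_cast hL.le)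
  have hL3 : (3 : ℝ) ≤ (L : ℝ) := by rw [← hFL']; exact three_le_memberL i
  obtain ⟨s3, -⟩ := windows_of_W hL3 (hα L hL).le (hef L hL).le (hWe L hL) (hWε L hL)
  have hWe' : 10 ^ 9 * (i.1.1.L : ℝ) ^ 2 * ef L ≤ 1 := by rw [hFL']; exact hWe L hL
  have hWε' : 10 ^ 12 * (i.1.1.L : ℝ) ^ 3 * α L ≤ 1 := by rw [hFL']; exact hWε L hL
  have hregα : RegPr i.1.1 i.1.2.1 i.1.2.2 (α L) U₀ := regPr_mono i.1.1 hαe hreg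
  have hα0 : 0 < α L := hα L hL; have he0 : 0 < ef L := hef L hL
  -- `‖H₁B̃‖ ≤ 2B₀α` from `norm_H₁` ∘ (20) and `L³·3L·ε₁ ≤ α`
  have hwin : (i.1.1.L : ℝ) ^ 3 * ε₁ ≤ 1 / 2 := by rw [hFL']; exact (windows_of_admissible hL1 hε₁.le hαe s3).1
  have hclose' : CloseAvg i.1.1 i.1.2.1 i.1.2.2 i.2.2.le ((i.1.1.L : ℝ) ^ 3 * ε₁) V U₀ := by rw [hFL']; exact hclose
  have hB := bound20_symLog_of_closeAvg i.1.1 i.2.2.le hε₁ hwin V U₀ hclose'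
  -- (R-B) the pinned datum is Hermitian-traceless, (R-A₁) the solution is real, (R-H₁)
  obtain ⟨-, -, hα16⟩ := windows_of_admissible hL1 hε₁.le hαe s3
  have h13 : (i.1.1.L : ℝ) ^ 3 * ε₁ ≤ 1 / 3 := by
    rw [hFL']
    have h0 : 0 ≤ (L : ℝ) ^ 3 * ε₁ := by positivity
    nlinarith only [h0, hαe.trans hα16, mul_nonneg h0 (by linarith only [hL1] : (0 : ℝ) ≤ 3 * (L : ℝ) - 1)]
  have hBR := bsym_isHermitian_trace_zero i.1.1 i.2.2.le V U₀ h13 hclose'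
  have hιA := hA₁R_of_letterReality B₀ C₄ a₃ α r hB₀ hC₄
    (fun (L : ℕ) (i : Idx L) (U₀ : GaugeField (i.1.1.P i.1.2.2) 0 (Matrix.specialUnitaryGroup (Fin 2) ℂ)) => frakGfR i.1.1 i.1.2.1 i.1.2.2 i.2.2.le (c₀ L) (cB L) (a L i) (DeltaOnePJ i.1.1 i.1.2.1 i.1.2.2 i.2.2.le (c₀ L) (cB L) (a L i)) U₀)
    (fun (L : ℕ) (i : Idx L) (U₀ : GaugeField (i.1.1.P i.1.2.2) 0 (Matrix.specialUnitaryGroup (Fin 2) ℂ)) => W80 (rieszτ frobEquiv) (LinearMap.toContinuousLinearMap (Matrix.traceLinearMap (Fin 2) ℂ ℂ)) (bgOfCfg i.1.1 i.1.2.2 U₀) (H1f i.1.1 i.1.2.1 i.1.2.2 i.2.2.le (c₀ L) (cB L) (a L i) (DeltaPiSlotP i.1.1 i.1.2.1 i.1.2.2 i.2.2.le (c₀ L) (cB L) (a L i)) U₀)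
            (fun A' => (-Complex.I) • CmapTwS i.1.1 i.1.2.1 i.1.2.2 i.2.2.le U₀ (((((eta i.1.1 i.1.2.1 i.1.2.2 : ℝ) : ℂ)) * Complex.I) • (fun b : PBond (i.1.1.P i.1.2.2) 0 => JetSup.equiv _ _ _ A' (bondEquiv i.1.1 i.1.2.2 b)))) (εC L) (Jcur (bgOfCfg i.1.1 i.1.2.2 U₀))
            (currentCLM frobEquiv (fun _ : Bond 3 (periodsT3 i.1.1 i.1.2.2) × Fin 3 => i.1.2.2 - i.1.2.1) (nabla115 (((i.1.1.L : ℝ)⁻¹) ^ (i.1.2.2 - i.1.2.1)) (bgOfCfg i.1.1 i.1.2.2 U₀)) (DeltaEtaSlot i.1.1 i.1.2.1 i.1.2.2 (c₀ L) U₀)))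
    (fun (L : ℕ) (i : Idx L) (U₀ : GaugeField (i.1.1.P i.1.2.2) 0 (Matrix.specialUnitaryGroup (Fin 2) ℂ)) => H1f i.1.1 i.1.2.1 i.1.2.2 i.2.2.le (c₀ L) (cB L) (a L i) (DeltaOnePJ i.1.1 i.1.2.1 i.1.2.2 i.2.2.le (c₀ L) (cB L) (a L i)) U₀)
    norm_G prop4 norm_H₁ hWε h𝒢R hWR hrα hr4 hr16 hH₁R L hL i ε₁ V U₀ hε₁ hV hreg hclose hαe A₁ hA₁ hsol
  have hH₁B : ‖H1f i.1.1 i.1.2.1 i.1.2.2 i.2.2.le (c₀ L) (cB L) (a L i) (DeltaOnePJ i.1.1 i.1.2.1 i.1.2.2 i.2.2.le (c₀ L) (cB L) (a L i)) U₀ (fun c : PBond (i.1.1.P i.1.2.1) 0 =>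
          (-Complex.I) • mlog (((V c : Matrix.specialUnitaryGroup (Fin 2) ℂ) : Matrix (Fin 2) (Fin 2) ℂ)
            * star ((descendTo i.1.1 ℰp i.1.2.1 i.1.2.2 i.2.2.le U₀ c : Matrix.specialUnitaryGroup (Fin 2) ℂ) : Matrix (Fin 2) (Fin 2) ℂ)))‖ ≤ 2 * B₀ L * α L := by
    have h0 := norm_H₁ L hL i _ U₀ hreg hαe (fun c : PBond (i.1.1.P i.1.2.1) 0 =>
          (-Complex.I) • mlog (((V c : Matrix.specialUnitaryGroup (Fin 2) ℂ) : Matrix (Fin 2) (Fin 2) ℂ)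
            * star ((descendTo i.1.1 ℰp i.1.2.1 i.1.2.2 i.2.2.le U₀ c : Matrix.specialUnitaryGroup (Fin 2) ℂ) : Matrix (Fin 2) (Fin 2) ℂ)))
    have hB' : ‖(fun c : PBond (i.1.1.P i.1.2.1) 0 =>
          (-Complex.I) • mlog (((V c : Matrix.specialUnitaryGroup (Fin 2) ℂ) : Matrix (Fin 2) (Fin 2) ℂ)
            * star ((descendTo i.1.1 ℰp i.1.2.1 i.1.2.2 i.2.2.le U₀ c : Matrix.specialUnitaryGroup (Fin 2) ℂ) : Matrix (Fin 2) (Fin 2) ℂ)))‖ ≤ 2 * α L := by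
      have h3 : 2 * ((3 : ℝ) * i.1.1.L) * ((i.1.1.L : ℝ) ^ 3 * ε₁) = 2 * ((L : ℝ) ^ 3 * (3 * (L : ℝ)) * ε₁) := by rw [hFL']; ring
      rw [h3] at hB; linarith only [hB, hαe]
    calc _ ≤ B₀ L * _ := h0
      _ ≤ B₀ L * (2 * α L) := mul_le_mul_of_nonneg_left hB' (hB₀ L hL).le
      _ = 2 * B₀ L * α L := by ring
  have hιB := hH₁R L hL i U₀ hregα _ hBR
  have hsplit0 : ∀ Z : Space115 (i.1.1.L : ℝ) (((i.1.1.L : ℝ)⁻¹) ^ (i.1.2.2 - i.1.2.1)) (fun _ : Bond 3 (periodsT3 i.1.1 i.1.2.2) => i.1.2.2 - i.1.2.1)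
          (fun _ : Bond 3 (periodsT3 i.1.1 i.1.2.2) × Fin 3 => i.1.2.2 - i.1.2.1) (nabla115 (((i.1.1.L : ℝ)⁻¹) ^ (i.1.2.2 - i.1.2.1)) (bgOfCfg i.1.1 i.1.2.2 U₀)), ∀ b' : PBond (i.1.1.P i.1.2.2) 0,
      JetSup.equiv _ _ _ (A₁ + Z) (bondEquiv i.1.1 i.1.2.2 b') = JetSup.equiv _ _ _ A₁ (bondEquiv i.1.1 i.1.2.2 b') + JetSup.equiv _ _ _ Z (bondEquiv i.1.1 i.1.2.2 b') :=
    fun Z b' => rfl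
  have hA'R : ∀ b' : PBond (i.1.1.P i.1.2.2) 0, star (JetSup.equiv _ _ _ (A₁ + H1f i.1.1 i.1.2.1 i.1.2.2 i.2.2.le (c₀ L) (cB L) (a L i) (DeltaOnePJ i.1.1 i.1.2.1 i.1.2.2 i.2.2.le (c₀ L) (cB L) (a L i)) U₀ (fun c : PBond (i.1.1.P i.1.2.1) 0 =>
          (-Complex.I) • mlog (((V c : Matrix.specialUnitaryGroup (Fin 2) ℂ) : Matrix (Fin 2) (Fin 2) ℂ)
            * star ((descendTo i.1.1 ℰp i.1.2.1 i.1.2.2 i.2.2.le U₀ c : Matrix.specialUnitaryGroup (Fin 2) ℂ) : Matrix (Fin 2) (Fin 2) ℂ)))) (bondEquiv i.1.1 i.1.2.2 b')) = JetSup.equiv _ _ _ (A₁ + H1f i.1.1 i.1.2.1 i.1.2.2 i.2.2.le (c₀ L) (cB L) (a L i) (DeltaOnePJ i.1.1 i.1.2.1 i.1.2.2 i.2.2.le (c₀ L) (cB L) (a L i)) U₀ (fun c : PBond (i.1.1.P i.1.2.1) 0 =>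
          (-Complex.I) • mlog (((V c : Matrix.specialUnitaryGroup (Fin 2) ℂ) : Matrix (Fin 2) (Fin 2) ℂ)
            * star ((descendTo i.1.1 ℰp i.1.2.1 i.1.2.2 i.2.2.le U₀ c : Matrix.specialUnitaryGroup (Fin 2) ℂ) : Matrix (Fin 2) (Fin 2) ℂ)))) (bondEquiv i.1.1 i.1.2.2 b') := fun b' => by
    rw [hsplit0, star_add, Matrix.star_eq_conjTranspose, Matrix.star_eq_conjTranspose, (hιA b').1.eq, (hιB b').1.eq]
  -- the radius: `‖A′‖ < r + 2B₀α ≤ a₃`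
  have hA'n : ‖A₁ + H1f i.1.1 i.1.2.1 i.1.2.2 i.2.2.le (c₀ L) (cB L) (a L i) (DeltaOnePJ i.1.1 i.1.2.1 i.1.2.2 i.2.2.le (c₀ L) (cB L) (a L i)) U₀ (fun c : PBond (i.1.1.P i.1.2.1) 0 =>
          (-Complex.I) • mlog (((V c : Matrix.specialUnitaryGroup (Fin 2) ℂ) : Matrix (Fin 2) (Fin 2) ℂ)
            * star ((descendTo i.1.1 ℰp i.1.2.1 i.1.2.2 i.2.2.le U₀ c : Matrix.specialUnitaryGroup (Fin 2) ℂ) : Matrix (Fin 2) (Fin 2) ℂ)))‖ < r L + 2 * B₀ L * α L := lt_of_le_of_lt (norm_add_le _ _) (add_lt_add_of_lt_of_le hA₁ hH₁B)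
  have hr0 : 0 ≤ r L := (norm_nonneg A₁).trans hA₁.le
  have ha3 := lt_of_lt_of_le hA'n (show r L + 2 * B₀ L * α L ≤ a₃ L by linarith only [hrα L hL, hr4 L hL, hr0])
  -- the (W-X′) rows at the member: `hρ` (trace duality), the Sect. C regime (in `(F.L : ℝ)` spelling), Prop. 3's `hC`, the chart's Hermitian readings `hPT`
  have hρ : ∀ (ℓ : Matrix (Fin 2) (Fin 2) ℂ →L[ℂ] ℂ) (X : Matrix (Fin 2) (Fin 2) ℂ),
      (LinearMap.toContinuousLinearMap (Matrix.traceLinearMap (Fin 2) ℂ ℂ) : Matrix (Fin 2) (Fin 2) ℂ →L[ℂ] ℂ) (rieszτ frobEquiv ℓ * X) = ℓ X := fun ℓ X => by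
    rw [LinearMap.coe_toContinuousLinearMap', Matrix.traceLinearMap_apply]; exact trace_rieszτ_frobEquiv_mul ℓ X
  have hRC' := hRC L hL i U₀ hregα
  rw [← hFL'] at hRC'
  have hC := prop4Hyp_CmapTwS_conj_zeroJet (F := i.1.1) (h := i.2.2.le) hα0 he0 hWe' hWε' U₀ hregα
  have hPT := T47_hermitian_readings_at_record (F := i.1.1) (h := i.2.2.le) (c₀ := c₀ L) (cB := cB L) (a := a L i) (ha L i).le hα0 he0 hWe' hWε' U₀ hregα hRC'
  exact hasDerivAt_actionZ_chartRay_real_member_eta (ha L i).le hα0 he0 hWe' hWε' U₀ hregα hρ hRC' hC hPT ha3 hA'R hδR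

end Summit.QuantumFields.YangMills.Theorems.Prop7HZ84FamilyAtRecord

end
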